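import Literature.NumberTheory.LFunctions.YoshidaWindowGramColumnData
import HarnessLib

/-!
# C∞ rung `R1E` (even sector) — DATA `RDN` part 1/1

Route context: Fourier–Galerkin / Schur-complement certificates of Weil positivity on a window ("format C", C∞ door `weilPositivityOn_of_cinf_pipeline`); supporting stmt-RiemannHypothesis-0098; seat rh-explicit-weil-2 (`cinfemit.py`/`emit_lean2.py`, HOME/rh-explicit-weil-2/gen17/EMITTER-PHASE2.md). Data / bookkeeping only; standard axioms; no RH claim.
-/

set_option autoImplicit false
-- `Summit.RiemannHypothesis.RiemannHypothesis.…` is the layout-mandated namespace (summit = problem name).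
set_option linter.dupNamespace false

namespace Summit.RiemannHypothesis.RiemannHypothesis.Theorems.WeilFormatC

open Literature.NumberTheory.LFunctions

namespace CinfR1E

/-- Packed rows part 1/1 of table `RDN` (word width 124, 1 words). -/
def RDN_P : List ℕ := [
  0x8000000000000000000028707715521,
  0x8000000000000000000028709f85f1a,
  0x80000000000000000000287118d9cba,
  0x800000000000000000002871e8c50d1,
  0x8000000000000000000028891dab68b,
  0x800000000000000000003ac111e1ca1,
  0x80000000000000000005d73561529e9,
  0x800000000000000000e5ea7dc50753c,
  0x8000000000000000161f8eacde479d0,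
  0x800000000000000175adc64001a0be0,
  0x80000000000000124ca79692f15eb90,
  0x80000000000000b43e972633233f2a3,
  0x80000000000005aebf39c83e8ebb97f,
  0x80000000000026ccf1d03c393566636,
  0x800000000000e5c2058f1836a4abe73,
  0x800000000004b356a76dcd2b433dddb,
  0x8000000000161f663248b5754dff138,
  0x80000000005ec8851fc9ca61ca27a15,
  0x800000000175ad9dc2bb10af4bbd829,
  0x800000000557de1841dc4aca2ec8672,
  0x80000000124ca76e12a8557e6097977,
  0x800000003b047a38a72a5c3d5786b33,
  0x80000000b43e96fdaf861d3458bfb33,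
  0x800000020bd30bfbe2f61675a467aca,
  0x80000005aebf399fb74bb90d0f6f619,
  0x8000000f230e1378c828f86abf8ab89,
  0x80000026ccf1d013adfa8e98f127be1,
  0x8000005ffc6c8cd97ed6f4c57f6b8fa,
  0x800000e5c2058eefa71fd6a317e8d20,
  0x800002155f0db1ebc098528f3b60959,
  0x800004b356a76da4972200000867d06,
  0x80000a535f544b2694d9c05e239349b,
  0x8000161f6632488cdc3d7cf73261ec3,
  0x80002e4c8ffdd9bb4ed2f148d031a93,
  0x80005ec8851fc9a1c376854142caf2c,
  0x8000be0d2092167ac9992d34ecad143,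
  0x800175ad9dc2bae80b5e66bb398aa99,
  0x8002d13d24d3161beb330778e5dcbe4,
  0x800557de1841dc222049767d941a852,
  0x8009f7750f8488c6a892e9e69da579f,
  0x80124ca76e12a82cce0fa97bf5e6dc5,
  0x802119415b21bf8bc7c205d56d18ee3,
  0x803b047a38a72a3385ee6f78f5cc9be,
  0x8067cf73c8b4013927a25fd3b2e880f,
  0x80b43e96fdaf85f47499a91a0eeb261,
  0x8135196f303a189813e2a8f45714bb4,
  0x820bd30bfbe2f5edaaedee13b0de1db,
  0x836db35546fe2636b29e7ef1516c81d,
  0x83cf64104e36c25a3bba57a30cc4c75,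
  0x87192f25f38cc42511060d0e23a5ee2,
  0x8ece99589a3f459bc480a7afc768433,
  0xa41f1d45f87b0290cc91da249eca0bd]

end CinfR1E

end Summit.RiemannHypothesis.RiemannHypothesis.Theorems.WeilFormatC
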